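import Summits.KontsevichZagierPeriods.KontsevichZagierPeriods.Theorems.RootDecompWalshStrataParab4Chart

/-!
# The paraboloid specimen, part 3/3: the second descent and the assembly

Route `RootDecompWalshStrata` (cell decomp-kz, lens 4, gen 11), support toward `QuadricSignKernel`
(item stmt-KontsevichZagierPeriods-25393), slice `d = 4`.  The source domain `C` of part 2 is the open
band `0 < w₂ < e(t) = √((1 − t₀²)/((1 − t₁)² + t₁²))` over the unit square; Newton–Leibniz along `w₂`
with the primitive `q((1 − w₀²)w₂²/2 − ((1−w₁)²+w₁²)w₂⁴/4)` (rule (3)) and opening the fibres (rule (1a))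
land on the RATIONAL 2-cell `S₂ = [(0,1)², q(1 − t₀²)²/(4((1 − t₁)² + t₁²))]` (value
`q·(8/15)·(π/8) = q·π/15`).  Main results: `of_cell_sub_of_pSqRep_mem_relations`
(`[paraboloid cell, q] − S₂ ∈ KZ.relations`) and `parab4_twoDescent` — the solid paraboloid
`x₃ > x₀² + x₁² + x₂²` in the unit 4-cube is a second instance (after the 4-ball) of the `d = 4` quadric
descent of the gen-11 node, decided INSIDE the three KZ rules (four moves: Newton–Leibniz, chart,
Newton–Leibniz, with two fibre-openings).  0 sorry.  [KontsevichZagier2001 §1.2]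
-/

noncomputable section
/-- `(1 − v)² + v² > 0`. [folklore] -/
private theorem gq_pos (v : ℝ) : 0 < (1 - v) ^ 2 + v ^ 2 := by nlinarith [sq_nonneg (1 - 2 * v)]

open Literature.NumberTheory.Transcendental
open MeasureTheory Set
open MvPolynomial (aeval X C)
open Literature.ModelTheory.ExponentialFields (IsSemialgebraic isSemialgebraic_setOf_eval_pos
  isSemialgebraic_setOf_eval_lt continuous_aeval_real)
open Summit.KontsevichZagierPeriods.RootDecompWalshStrata.WalshSpanProof (isSemialgebraic_cubeSet
  isBounded_cubeSet cellRep cellRep_domain cellRep_integrand)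
open Summit.KontsevichZagierPeriods.RootDecompWalshStrata.Ball4 (sqSet isSemialgebraic_sqSet sqSet_subset_Icc half_le_gq)

namespace Summit.KontsevichZagierPeriods.RootDecompWalshStrata.Parab4

/-! #### The rational 2-cell `S₂ = [(0,1)², q(1 − t₀²)²/(4((1 − t₁)² + t₁²))]` -/

/-- The denominator `4((1 − v)² + v²)` is positive. [folklore] -/
theorem den_pos (v : ℝ) : 0 < 4 * ((1 - v) ^ 2 + v ^ 2) := mul_pos four_pos (gq_pos v)

/-- `S₂ = [(0,1)², q(1 − t₀²)²/(4((1 − t₁)² + t₁²))]`: a RATIONAL function on a rational 2-cell (value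
`q·π/15`). [KontsevichZagier2001 §1.1] -/
def pSqRep (q : ℚ) : KZ.IntegralRep 2 where
  domain := sqSet
  integrand t := (q : ℝ) * (1 - t 0 ^ 2) ^ 2 / (4 * ((1 - t 1) ^ 2 + t 1 ^ 2))
  isSemialgebraic_domain := isSemialgebraic_sqSet
  isSemialgebraicFunOn_integrand :=
    (isSemialgebraicFunOn_aeval_div_aeval isSemialgebraic_sqSet (C q * (1 - X 0 ^ 2) ^ 2)
      (4 * ((1 - X 1) ^ 2 + X 1 ^ 2)) fun t _ => by simpa using (den_pos (t 1)).ne').congr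
      fun t _ => by simp
  integrableOn := by
    refine (ContinuousOn.integrableOn_compact isCompact_Icc ?_).mono_set sqSet_subset_Icc
    have hc : Continuous fun t : Fin 2 → ℝ =>
        (q : ℝ) * (1 - t 0 ^ 2) ^ 2 / (4 * ((1 - t 1) ^ 2 + t 1 ^ 2)) := by
      refine (continuous_const.mul ((continuous_const.sub ((continuous_apply 0).pow 2)).pow 2)).div
        ?_ fun t => (den_pos (t 1)).ne'
      exact continuous_const.mul (((continuous_const.sub (continuous_apply 1)).pow 2).add
        ((continuous_apply 1).pow 2))
    exact hc.continuousOn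

/-- The domain of `S₂`. [definition] -/
@[simp] theorem pSqRep_domain (q : ℚ) : (pSqRep q).domain = sqSet := rfl

/-- The integrand of `S₂`. [definition] -/
@[simp] theorem pSqRep_integrand (q : ℚ) (t : Fin 2 → ℝ) :
    (pSqRep q).integrand t = (q : ℝ) * (1 - t 0 ^ 2) ^ 2 / (4 * ((1 - t 1) ^ 2 + t 1 ^ 2)) := rfl

/-- **`S₂` is a rational representation of dimension 2.** [KontsevichZagier2001 §1.1] -/
theorem isRational_pSqRep (q : ℚ) : (pSqRep q).IsRational := by
  refine ⟨C q * (1 - X 0 ^ 2) ^ 2, 4 * ((1 - X 1) ^ 2 + X 1 ^ 2), fun t _ => ?_, fun t _ => ?_⟩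
  · simpa using (den_pos (t 1)).ne'
  · simp

/-! #### The band: `C` is the open band `0 < w₂ < √((1 − t₀²)/((1 − t₁)² + t₁²))` over `(0,1)²` -/

/-- Coordinates of `Fin.snoc` on `ℝ² × ℝ`. [definition] -/
@[simp] private theorem snoc₂_apply (t : Fin 2 → ℝ) (s : ℝ) :
    (Fin.snoc t s : Fin 3 → ℝ) 2 = s ∧ (Fin.snoc t s : Fin 3 → ℝ) 0 = t 0 ∧
      (Fin.snoc t s : Fin 3 → ℝ) 1 = t 1 := ⟨rfl, rfl, rfl⟩

/-- The upper edge `e(t) = √((1 − t₀²)/((1 − t₁)² + t₁²))` of the band. -/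
def pEdge (t : Fin 2 → ℝ) : ℝ := √((1 - t 0 ^ 2) / ((1 - t 1) ^ 2 + t 1 ^ 2))

/-- The upper edge is `ℚ`-semialgebraic on the square. [BCR1998 §2.2] -/
theorem isSemialgebraicFunOn_pEdge : IsSemialgebraicFunOn ℚ sqSet pEdge :=
  (IsSemialgebraicFunOn.sqrt_holds
    (isSemialgebraicFunOn_aeval_div_aeval isSemialgebraic_sqSet (1 - X 0 ^ 2 : MvPolynomial (Fin 2) ℚ)
      ((1 - X 1) ^ 2 + X 1 ^ 2) fun t _ => by simpa using (gq_pos (t 1)).ne')).congr fun t _ => by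
    simp [pEdge]

/-- On the square, `e(t)² = (1 − t₀²)/((1 − t₁)² + t₁²)`. [folklore] -/
theorem pEdge_sq {t : Fin 2 → ℝ} (ht : t ∈ sqSet) :
    pEdge t ^ 2 = (1 - t 0 ^ 2) / ((1 - t 1) ^ 2 + t 1 ^ 2) := by
  have h0 := ht 0
  exact Real.sq_sqrt (div_pos (by nlinarith) (gq_pos (t 1))).le

/-- `e(t) < 2`. [folklore] -/
theorem pEdge_lt_two (t : Fin 2 → ℝ) : pEdge t < 2 := by
  refine (Real.sqrt_lt' two_pos).2 ((div_lt_iff₀ (gq_pos (t 1))).2 ?_)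
  nlinarith [half_le_gq (t 1), sq_nonneg (t 0)]

/-- Membership in `C` in band form. [folklore] -/
theorem mem_cSrcSet_iff_init (w : Fin 3 → ℝ) :
    w ∈ cSrcSet ↔ Fin.init w ∈ sqSet ∧ 0 < w (Fin.last 2) ∧ w (Fin.last 2) < pEdge (Fin.init w) := by
  rw [mem_cSrcSet]
  have hG := gq_pos (w 1)
  have key : w 2 ^ 2 * ((1 - w 1) ^ 2 + w 1 ^ 2) = (w 2 * (1 - w 1)) ^ 2 + (w 2 * w 1) ^ 2 := by
    ring
  have hsq : Fin.init w ∈ sqSet ↔ (0 < w 0 ∧ w 0 < 1) ∧ (0 < w 1 ∧ w 1 < 1) := by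
    simp only [sqSet, mem_setOf_eq, Fin.init]
    exact ⟨fun hu => ⟨hu 0, hu 1⟩, fun ⟨h0, h1⟩ j => by fin_cases j <;> assumption⟩
  have hb : pEdge (Fin.init w) = √((1 - w 0 ^ 2) / ((1 - w 1) ^ 2 + w 1 ^ 2)) := rfl
  have hl : w (Fin.last 2) = w 2 := rfl
  rw [hsq, hb, hl]
  constructor
  · rintro ⟨h0, h1, h2, hP⟩
    refine ⟨⟨h0, h1⟩, h2, (Real.lt_sqrt h2.le).2 ((lt_div_iff₀ hG).2 ?_)⟩
    rw [key]
    linarith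
  · rintro ⟨⟨h0, h1⟩, h2, hlt⟩
    have h' : w 2 ^ 2 < (1 - w 0 ^ 2) / ((1 - w 1) ^ 2 + w 1 ^ 2) := (Real.lt_sqrt h2.le).1 hlt
    have h'' : w 2 ^ 2 * ((1 - w 1) ^ 2 + w 1 ^ 2) < 1 - w 0 ^ 2 := (lt_div_iff₀ hG).1 h'
    refine ⟨h0, h1, h2, ?_⟩
    rw [key] at h''
    linarith

/-- The closed band lies in `[0,2]³`. [folklore] -/
theorem band_sqSet_subset_Icc : KZlog.band sqSet (fun _ => (0:ℝ)) pEdge ⊆ Icc 0 2 := by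
  intro w hw
  rw [KZlog.mem_band] at hw
  obtain ⟨hu, h0, h1⟩ := hw
  have hlt := pEdge_lt_two (Fin.init w)
  refine ⟨fun j => ?_, fun j => ?_⟩
  · fin_cases j
    · exact (hu 0).1.le
    · exact (hu 1).1.le
    · exact h0
  · fin_cases j
    · exact ((hu 0).2.trans one_lt_two).le
    · exact ((hu 1).2.trans one_lt_two).le
    · exact (h1.trans hlt.le)

/-! #### Moves (3) + (1a): `[C, …] ≡ S₂` -/

/-- **Moves (3) + (1a):** Newton–Leibniz along `w₂` with the primitive
`q((1 − w₀²)w₂²/2 − ((1−w₁)²+w₁²)w₂⁴/4)` over the unit square (closed fibres `[0, e(t)]`), then opening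
the fibres: `[C, …] − S₂ ∈ KZ.relations`. [KontsevichZagier2001 §1.2 rules (1), (3)] -/
theorem of_cSrcRep_sub_of_pSqRep_mem_relations (q : ℚ) :
    KZ.of (cSrcRep q) - KZ.of (pSqRep q) ∈ KZ.relations := by
  have hBs := isSemialgebraic_sqSet
  have ha : IsSemialgebraicFunOn ℚ sqSet (fun _ => (0:ℝ)) := by
    simpa using isSemialgebraicFunOn_ratCast hBs 0
  have hb : IsSemialgebraicFunOn ℚ sqSet pEdge := isSemialgebraicFunOn_pEdge
  have hband : IsSemialgebraic ℚ (KZlog.band sqSet (fun _ => (0:ℝ)) pEdge) :=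
    KZlog.isSemialgebraic_band ha hb
  set F : (Fin 3 → ℝ) → ℝ := fun w =>
    (q : ℝ) * ((1 - w 0 ^ 2) * w 2 ^ 2 / 2 - ((1 - w 1) ^ 2 + w 1 ^ 2) * w 2 ^ 4 / 4) with hFdef
  have hbdry : ∀ t ∈ sqSet,
      F (Fin.snoc t (pEdge t)) - F (Fin.snoc t ((fun _ => (0:ℝ)) t)) = (pSqRep q).integrand t := by
    intro t ht
    simp only [hFdef, snoc₂_apply, pSqRep_integrand]
    have h4 : pEdge t ^ 4 = (pEdge t ^ 2) ^ 2 := by ring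
    rw [h4, pEdge_sq ht]
    have hG1 := (gq_pos (t 1)).ne'
    field_simp
    ring
  obtain ⟨rb, rd, hrbd, hrbi, hrdd, hrdi, hrel⟩ := KZ.exists_band_newtonLeibniz hBs
    (fun _ => (0:ℝ)) pEdge ha hb (fun _ _ => Real.sqrt_nonneg _) F
    (fun w => (q : ℝ) * (1 - w 0 ^ 2 - (w 2 * (1 - w 1)) ^ 2 - (w 2 * w 1) ^ 2) * w 2)
    ((isSemialgebraicFunOn_aeval hband
      (C (q / 2) * (1 - X 0 ^ 2) * X 2 ^ 2 - C (q / 4) * ((1 - X 1) ^ 2 + X 1 ^ 2) * X 2 ^ 4)).congr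
      fun w _ => by
        simp only [hFdef]
        simp
        ring)
    ((isSemialgebraicFunOn_aeval hband
      (C q * (1 - X 0 ^ 2 - (X 2 * (1 - X 1)) ^ 2 - (X 2 * X 1) ^ 2) * X 2)).congr fun w _ => by simp)
    (fun t _ => by
      simp only [hFdef, snoc₂_apply]
      exact (continuous_const.mul (((continuous_const.mul (continuous_pow 2)).div_const _).sub
        ((continuous_const.mul (continuous_pow 4)).div_const _))).continuousOn)
    (fun t _ s _ => by
      simp only [hFdef, snoc₂_apply]
      exact (((((hasDerivAt_pow 2 s).const_mul (1 - t 0 ^ 2)).div_const 2).sub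
        (((hasDerivAt_pow 4 s).const_mul ((1 - t 1) ^ 2 + t 1 ^ 2)).div_const 4)).const_mul
        (q : ℝ)).congr_deriv (by ring))
    (((continuous_cSrcInt q).continuousOn.integrableOn_compact isCompact_Icc).mono_set
      band_sqSet_subset_Icc)
    ((pSqRep q).isSemialgebraicFunOn_integrand.congr fun t ht => (hbdry t ht).symm)
    (((pSqRep q).integrableOn.congr_fun (fun t ht => (hbdry t ht).symm)
      isSemialgebraic_sqSet.measurableSet_holds))
  obtain ⟨rb', hrb'd, hrb'i, hrel'⟩ := KZ.of_sub_of_restrict_openBand_mem_relations ha hb rb hrbd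
  have hpin1 : KZ.of rb' - KZ.of (cSrcRep q) ∈ KZ.relations := by
    refine KZ.of_sub_of_mem_relations_of_eqOn ?_ fun w _ => ?_
    · rw [hrb'd, cSrcRep_domain]
      ext w
      exact mem_cSrcSet_iff_init w
    · rw [hrb'i, hrbi]
      rfl
  have hpin2 : KZ.of rd - KZ.of (pSqRep q) ∈ KZ.relations := by
    refine KZ.of_sub_of_mem_relations_of_eqOn ?_ fun t ht => ?_
    · rw [pSqRep_domain, hrdd]
    · rw [hrdi]
      rw [hrdd] at ht
      exact hbdry t ht
  have : KZ.of (cSrcRep q) - KZ.of (pSqRep q) =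
      (KZ.of rb - KZ.of rd) - (KZ.of rb - KZ.of rb') - (KZ.of rb' - KZ.of (cSrcRep q)) +
        (KZ.of rd - KZ.of (pSqRep q)) := by abel
  rw [this]
  exact add_mem (sub_mem (sub_mem hrel hrel') hpin1) hpin2

/-! #### Assembly: the paraboloid cell lands on the rational 2-cell `S₂` -/

/-- **`[(0,1)⁴ ∩ {x₃ > x₀² + x₁² + x₂²}, q] − S₂ ∈ KZ.relations`:** the solid paraboloid in the unit
4-cube with constant weight `q` is equivalent under the three KZ rules to the RATIONAL dimension-2
representation `S₂ = [(0,1)², q(1 − t₀²)²/(4((1 − t₁)² + t₁²))]` (`q·π/15` both sides; four moves).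
[KontsevichZagier2001 §1.2; this node] -/
theorem of_cell_sub_of_pSqRep_mem_relations (q : ℚ) :
    KZ.of (cellRep parab4Poly q) - KZ.of (pSqRep q) ∈ KZ.relations := by
  have h1 := of_cell_sub_of_b3WRep_mem_relations q
  have h2 := of_cSrcRep_sub_of_b3WRep_mem_relations q
  have h3 := of_cSrcRep_sub_of_pSqRep_mem_relations q
  have : KZ.of (cellRep parab4Poly q) - KZ.of (pSqRep q) =
      (KZ.of (cellRep parab4Poly q) - KZ.of (b3WRep q)) -
        (KZ.of (cSrcRep q) - KZ.of (b3WRep q)) + (KZ.of (cSrcRep q) - KZ.of (pSqRep q)) := by abel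
  rw [this]
  exact add_mem (sub_mem h1 h2) h3

/-- **The solid paraboloid is an instance of the `d = 4` quadric descent** (`P = x₃ − x₀² − x₁² − x₂²`,
any rational weight `q`): every representation with the paraboloid cell as domain and integrand `q` is
equivalent, modulo `KZ.relations`, to an element of the closure of the RATIONAL representations of
dimension `≤ 2`.  Decided INSIDE the rules; the `P := parab4Poly` instance of `QuadricTwoDescentFour`
(gen-11 node).  [KontsevichZagier2001 §1.2; this node] -/
theorem parab4_twoDescent (q : ℚ) (ρ : KZ.IntegralRep 4)
    (hρ : ρ.domain = {x | (∀ j, 0 < x j ∧ x j < 1) ∧ 0 < MvPolynomial.aeval x parab4Poly} ∧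
      ∀ x ∈ ρ.domain, ρ.integrand x = (q : ℝ)) :
    ∃ y ∈ AddSubgroup.closure
        {y : KZ.FormalRep | ∃ (m : ℕ) (N : KZ.IntegralRep m), m ≤ 2 ∧ N.IsRational ∧ y = KZ.of N},
      KZ.of ρ - y ∈ KZ.relations := by
  refine ⟨KZ.of (pSqRep q),
    AddSubgroup.subset_closure ⟨2, pSqRep q, le_rfl, isRational_pSqRep q, rfl⟩, ?_⟩
  have hpin : KZ.of ρ - KZ.of (cellRep parab4Poly q) ∈ KZ.relations :=
    KZ.of_sub_of_mem_relations_of_eqOn hρ.1.symm fun x hx => by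
      rw [hρ.2 x hx, cellRep_integrand]
  have : KZ.of ρ - KZ.of (pSqRep q) =
      (KZ.of ρ - KZ.of (cellRep parab4Poly q)) +
        (KZ.of (cellRep parab4Poly q) - KZ.of (pSqRep q)) := by abel
  rw [this]
  exact add_mem hpin (of_cell_sub_of_pSqRep_mem_relations q)

end Summit.KontsevichZagierPeriods.RootDecompWalshStrata.Parab4

end
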